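import Summits.QuantumFields.BalabanUV.Beta.GAN24.LegTowerRows
import Summits.QuantumFields.BalabanUV.Beta.GAN24.WSlotT2OfPieces

/-!
# `BalabanUV.Beta.GAN24.LegTowerSlavedRows` — binder row G-an2-4 ∕ (CONV-C), W-slot, the (α-0) parity re-cut, row L11 (Q-L): **THE (Q-L) END RE-TYPED IN
# PREDICATE CURRENCY WITH THE SLAVED LONGITUDINAL TERM** — the OWNER gan24-p1 g33's RULING R-gan24p1-g33-2 (3) «(Q-L) for the capstone := (H1)^{⊥} — the
# k₀-fold leg chain contracts on the slot-divergence-free class — PLUS the longitudinal (slaved) part carried level by level», TYPED (G-an2-4 formalisation swarm,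
# leaf prover `b2b-balaban-gan24-formalise-leaf-03`, gen 67; FILE 1 of the journal INTENT [LEAF03-G67-ONLINE] «(Q-L) LETTER ROWS ⟸ THE RULED DISPLAY»; continues MY
# g60 `GAN24/LegTowerRows` (the (Q-L) END in size-FUNCTIONAL currency) over the OWNER g25's `TowerBoundKFold`)

NOT IN PRINT; OUR BOOKKEEPING ([folklore] window bookkeeping BY NAME; 0 `def`, 0 cited facts, 0 `def … : Prop`, 0 sorry).  HONEST FRAMING (cell contract,
verbatim): «discharging `BetaPertH` makes Bałaban's UV stability UNCONDITIONAL — a real constructive-QFT result; it is NOT the continuum limit and NOT the Clay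
problem.»  HONEST DEPENDENCY (verbatim): «continuum YM on T⁴ ⇐ BetaPertH ∧ nine spine estimates (0/9 proved); BetaPertH ⇐ (D1) ∧ (D4) ∧ CAP+tail; G-an2-4
gates asym, D1 and NE2/3/4.»

WHY.  MY g60 END `LegTowerRows.sz_rdiv_tower_le_of_window` bounds the right-divergenced leg tower `Δ n := fun s ↦ rdiv (T n s)` uniformly in the level in a size
FUNCTIONAL `sz` (subadditive on ALL tables) modulo (H1) «the k₀-fold pure leg chain contracts on k₀-fold block sums of the class».  Two things the consumers
(FILE 3c `T2ShapeEvenMemberOfWardLetters` ∕ leaf-01's `T2DriftEvenMemberOfWardLetters`: the LEG LETTER ROWS `hL₁ hL₂` are `LocStencil₂` rows at ONE rate, ONE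
constant, EVERY level) and the OWNER's ruling ask for: (i) the size must be a PREDICATE `Good X c` («`X` has letter size `≤ c`», e.g. `LocStencil₂ X c δ`), not a
functional — a `LocStencil₂` letter size is not a real-valued subadditive functional on all tables, and no `sInf` is wanted; (ii) (H1) as displayed may die on the
slot pure-gauge (longitudinal) mode (RULING -2 (3): «(H1) holds iff the LEG FACTOR's `sz`-norm beats the slot transport's eigenvalue 1 on the longitudinal mode, ONE
number» — E44, not run), so the display must be (H1)^{⊥} — contraction on the slot-divergence-FREE class — with the longitudinal amplitude of the particular member
SLAVED (for the even member: `divW (rdiv y_l) = rdiv (divW y_l)` = `rdiv` of the residual-FREE slaved divergence, MY g65 `LegSlotDivergenceCommute` ⨾ leaf-01's (b1)).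

WHAT.
* §1 ABSTRACT (any type `E` with `+`; a tower `x : ℕ → E` with a k₀-WINDOW FORM `x (n + k₀) = Φ n (x n) + S n` — `Φ n` the k₀-fold chain from level `n`, `S n` the
  window's pushed sources — whose members lie in a class `P`): **`good_window`**, **`good_tower_of_kfold_slaved`** — for ANY size predicate `Good : E → ℝ → Prop`
  that is SUBADDITIVE (`Good X c → Good Y c′ → Good (X + Y) (c + c′)`) and MONOTONE in the constant, and ANY second predicate `GoodL : E → ℝ → Prop` («longitudinal
  amplitude `≤ g`»; NO structure assumed): IF
  **(H1♮)** `∀ n X c g, P X → Good X c → GoodL X g → Good (Φ n X) (θ·c + Cg·g)` (`0 ≤ θ < 1`, `0 ≤ Cg`) — THE RULED DISPLAY: on `{X ∣ GoodL X 0}` (the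
  slot-divergence-free class when `GoodL` is the slot-divergence letter) it IS (H1)^{⊥} «the k₀-fold chain contracts»; off it the longitudinal amplitude enters as a
  SOURCE; g60's (H1) ⟹ (H1♮) with `Cg = 0`, so nothing typed is lost —,
  (H2) `∀ n, Good (S n) s`, (H0) `∀ i < k₀, Good (x i) M`, **(H3)** `∀ n, GoodL (x n) σ` — THE SLAVED PART, carried level by level —,
  THEN `∀ n, Good (x n) (M + (Cg·σ + s)·(1 − θ)⁻¹)` (the window inequality along `k₀·q + r` in predicate currency + `TowerBoundKFold.geom_sum_le_inv_one_sub`).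
* §2 THE LEG TOWER (g60's objects: `Δ n := fun s ↦ rdiv (T n s)` under the closed one-step law `hstep`, step maps `legStepB kc K N`, sources `rdiv ∘ F m`, a class
  `P` with g60's four class rows; the window form and membership are g60's `rdiv_tower_window` ∕ `mem_rdiv_tower`, the chain form of `Φ` is g60 part 3's
  `transport_legStepB_eq`): **`good_rdiv_tower_of_window_slaved`** — (H1♮) in chain form
  `P W → bounded W → Good W c → GoodL W g → Good (legChain kc K N n k₀ (fun s ↦ bsumPow N k₀ (W s))) (θ·c + Cg·g)`, (H2) on the source window, (H0), (H3) ⟹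
  `∀ n, Good (Δ n) (M + (Cg·σ + s)·(1 − θ)⁻¹)`; `…_bdd` (the bounded class), `…_of_rec` (from the affine `lin4` recursion itself), `…_comb` (the dressed comb tower
  `K♮ᴱ_m`, `N = Lc`, `kc m = −(c m·(Lc^{d+1})⁻¹)`) — g60's `sz_rdiv_tower_le_of_window{,_bdd,_of_rec,_comb}` with `sz X ≤ c` ↦ `Good X c` and (H1) ↦ (H1♮) + (H3).
* §3 `LocStencil₂` CURRENCY: `Good := fun X c ↦ LocStencil₂ X c δ` is subadditive ∕ monotone (leaf-10's `WSlotT2OfPieces.locStencil₂_add ∕ locStencil₂_mono` BY NAME) ⟹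
  **`locStencil₂_rdiv_tower_of_window_slaved_comb`**: `∀ n, LocStencil₂ (fun s ↦ rdiv (T n s)) (M + (Cg·σ + s)·(1 − θ)⁻¹) δ` — ONE constant, EVERY level: the
  right-LEG LETTER ROW's shape up to the sign of the difference (FILE 2 `LegLetterParity`), for the dressed comb tower with a FIXED in-block root (the even member's
  law, FILE 3).
(H1♮) ∕ (H2) ∕ (H0) ∕ (H3) are DISPLAYED, NOT discharged: (H1♮) is the located content of (Q-L) in its RULED form (idea-1's (Q-L-k₀) ∕ the OWNER's E44 decide it);
(H2) ⟸ the source rows ⨾ (LAY-leg); (H3) ⟸ (b1) ⨾ `LegSlotDivergenceCommute` — later files.  Asserts NO bound on any chain; discharges NOTHING of (Q-L) ∕ (Q-R) ∕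
(C) ∕ «T2Shape» ∕ «T2Drift» ∕ (hW, hWall); 0 wall binders; NEVER «G-an2-4 closed» as (CONV-C); NOT D1, NOT `BetaPertH`, NOT continuum, NOT Clay; not in print.
Unit `b2b-balaban-gan24-formalise-leaf-03` (gen 67), 2026-08-23.
-/

noncomputable section
open Finset
open scoped BigOperators
open Literature.MathematicalPhysics.QuantumFieldTheory
open Literature.MathematicalPhysics.QuantumFieldTheory.Balaban1983to89
open Literature.MathematicalPhysics.QuantumFieldTheory.Balaban1983to89.Beta
open B6BondElimination (unitVec)
open ExpKernelCalculus (MKer Site Decays)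
open OneStepResolventKernel (Fib)
open OneStepKernelFamily (colH KInvStep)
open AffineAveraging (box toSite)
open BalabanCompositeJets (LocStencil₂)
open Summit.QuantumFields.BalabanUV.Beta.KernelWardRelative (gaugeWt)
open Summit.QuantumFields.BalabanUV.Beta.GAN24.T2RecursionAffine (lin4)
open Summit.QuantumFields.BalabanUV.Beta.HessKerDressedUnits (unitK decays_unitK)
open Summit.QuantumFields.BalabanUV.Beta.GAN24.CombesThomas (sfStep smStep)
open Summit.QuantumFields.BalabanUV.Beta.AxialDressingRooted (coDressKBmAt one_le_of_neZero decays_coDressKBmAt_KInvStep)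
open Summit.QuantumFields.BalabanUV.Beta.GAN24.Lin4SlotDivergence (hH_unitK_comb)
open Summit.QuantumFields.BalabanUV.Beta.GAN24.Lin4LegDivergence (hM_unitK_comb)
open Summit.QuantumFields.BalabanUV.Beta.GAN24.Lin4LegTower (rdiv bsum legStep rdiv_lin4_affine)
open Summit.QuantumFields.BalabanUV.Beta.GAN24.Lin4LegTowerUnroll (legStepB bsumPow legChain transport_legStepB_eq bddTab_rdiv bddTab_legStepB)
open Summit.QuantumFields.BalabanUV.Beta.GAN24.AffineUnroll (transport)
open Summit.QuantumFields.BalabanUV.Beta.GAN24.T2UnitSplitLevels (bdd₄_add)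
open Summit.QuantumFields.BalabanUV.Beta.GAN24.TowerBoundKFold (geom_sum_le_inv_one_sub)
open Summit.QuantumFields.BalabanUV.Beta.GAN24.LegTowerRows (rdiv_tower_window rdiv_tower_window_chain mem_rdiv_tower)
open Summit.QuantumFields.BalabanUV.Beta.GAN24.WSlotT2OfPieces (locStencil₂_add locStencil₂_mono)

namespace Summit.QuantumFields.BalabanUV.Beta.GAN24.LegTowerSlavedRows

/-! ## §1 Abstract: a k₀-window tower in predicate currency, contraction modulo a slaved longitudinal amplitude -/

section Abstract

variable {E : Type*}

/-- [folklore] **THE WINDOW INEQUALITY IN PREDICATE CURRENCY.**  If the window step `x n ↦ x (n + k₀)` maps `Good (x n) c` to `Good (x (n + k₀)) (θ·c + S)`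
and `Good (x i) M` on the first window `i < k₀`, then along the arithmetic progression `k₀·q + r` (`r < k₀`) the member has size
`θ^q·M + S·Σ_{i<q} θ^i` — the OWNER's `TowerBoundKFold.window_bound` with `a n ≤ ·` ↦ `Good (x n) ·` (monotonicity of `Good` in the constant replaces `≤`-transitivity). -/
theorem good_window {Good : E → ℝ → Prop} (hGmono : ∀ X c c', c ≤ c' → Good X c → Good X c') {x : ℕ → E} {k₀ : ℕ} {θ S M : ℝ}
    (hwin : ∀ n c, Good (x n) c → Good (x (n + k₀)) (θ * c + S)) (H0 : ∀ i, i < k₀ → Good (x i) M) (q r : ℕ) (hr : r < k₀) :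
    Good (x (k₀ * q + r)) (θ ^ q * M + S * ∑ i ∈ Finset.range q, θ ^ i) := by
  induction q with
  | zero => simpa using H0 r hr
  | succ q ih =>
    have e : k₀ * (q + 1) + r = (k₀ * q + r) + k₀ := by ring
    rw [e]
    refine hGmono _ _ _ (le_of_eq ?_) (hwin _ _ ih)
    rw [Finset.sum_range_succ', pow_zero, pow_succ]
    have hs : ∑ i ∈ range q, θ ^ (i + 1) = ∑ i ∈ range q, θ * θ ^ i := Finset.sum_congr rfl (fun i _ => by ring)
    rw [hs, ← Finset.mul_sum]
    ring

/-- NOT IN PRINT; OUR BOOKKEEPING.  **THE k₀-WINDOW TOWER SOCKET IN PREDICATE CURRENCY, CONTRACTION MODULO A SLAVED LONGITUDINAL AMPLITUDE** (RULING R-gan24p1-g33-2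
(3) typed).  Data: a tower `x : ℕ → E` with the k₀-window form `x (n + k₀) = Φ n (x n) + S n` (`hwin`; `Φ n` the k₀-fold chain from level `n`, `S n` the window's
pushed sources) all of whose members lie in a class `P` (`hxP`); a size predicate `Good` that is subadditive (`hGadd`) and monotone in the constant (`hGmono`); a
second predicate `GoodL` («longitudinal amplitude `≤ g`»), no structure assumed.  IF
(H1♮) `P X → Good X c → GoodL X g → Good (Φ n X) (θ·c + Cg·g)` for every level `n` (`0 ≤ θ < 1`, `0 ≤ Cg`) — contraction MODULO the longitudinal amplitude: on
`{GoodL · 0}` it is the plain k₀-fold contraction (H1)^{⊥}; with `Cg = 0` it is g60's (H1) —,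
(H2) `Good (S n) s` for every `n` (`0 ≤ s`), (H0) `Good (x i) M` for `i < k₀` (`0 ≤ M`), (H3) `GoodL (x n) σ` for every `n` (`0 ≤ σ`; THE SLAVED PART),
THEN `Good (x n) (M + (Cg·σ + s)·(1 − θ)⁻¹)` for EVERY level `n`.  Nothing of (H1♮) ∕ (H3) is claimed here. -/
theorem good_tower_of_kfold_slaved [AddCommMonoid E] {Good GoodL : E → ℝ → Prop} {P : E → Prop}
    (hGadd : ∀ X Y c c', Good X c → Good Y c' → Good (X + Y) (c + c')) (hGmono : ∀ X c c', c ≤ c' → Good X c → Good X c')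
    {x : ℕ → E} {Φ : ℕ → E → E} {S : ℕ → E} {k₀ : ℕ} (hk : 0 < k₀) (hwin : ∀ n, x (n + k₀) = Φ n (x n) + S n) (hxP : ∀ n, P (x n))
    {θ Cg s M σ : ℝ} (hθ0 : 0 ≤ θ) (hθ1 : θ < 1) (hCg : 0 ≤ Cg) (hs : 0 ≤ s) (hM : 0 ≤ M) (hσ : 0 ≤ σ)
    (H1 : ∀ n X c g, P X → Good X c → GoodL X g → Good (Φ n X) (θ * c + Cg * g))
    (H2 : ∀ n, Good (S n) s) (H0 : ∀ i, i < k₀ → Good (x i) M) (H3 : ∀ n, GoodL (x n) σ) (n : ℕ) :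
    Good (x n) (M + (Cg * σ + s) * (1 - θ)⁻¹) := by
  -- the window step in predicate currency: the chain term by (H1♮) at the slaved amplitude (H3), the sources by (H2), subadditivity
  have hstep : ∀ m c, Good (x m) c → Good (x (m + k₀)) (θ * c + (Cg * σ + s)) := fun m c hc => by
    rw [hwin m]
    exact hGmono _ _ _ (le_of_eq (by ring)) (hGadd _ _ _ _ (H1 m _ _ _ (hxP m) hc (H3 m)) (H2 m))
  have hn : n = k₀ * (n / k₀) + n % k₀ := (Nat.div_add_mod n k₀).symm
  rw [hn]
  refine hGmono _ _ _ ?_ (good_window hGmono hstep H0 (n / k₀) (n % k₀) (Nat.mod_lt n hk))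
  have h1 : θ ^ (n / k₀) * M ≤ M := by
    have : θ ^ (n / k₀) ≤ 1 := pow_le_one₀ hθ0 hθ1.le
    nlinarith
  have h2 : (Cg * σ + s) * ∑ i ∈ range (n / k₀), θ ^ i ≤ (Cg * σ + s) * (1 - θ)⁻¹ :=
    mul_le_mul_of_nonneg_left (geom_sum_le_inv_one_sub hθ0 hθ1 _) (by positivity)
  linarith

/-- [folklore] **g60's (H1) IS THE CASE `Cg = 0` OF (H1♮)**: a plain k₀-fold contraction `P X → Good X c → Good (Φ n X) (θ·c)` gives (H1♮) with `Cg = 0` for ANY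
`GoodL` — nothing typed under g60's display is lost under the ruled one. -/
theorem h1_slaved_of_h1 {Good GoodL : E → ℝ → Prop} {P : E → Prop} {Φ : ℕ → E → E} {θ : ℝ}
    (H1 : ∀ n X c, P X → Good X c → Good (Φ n X) (θ * c)) (n : ℕ) (X : E) (c g : ℝ) (hX : P X) (hc : Good X c) (_hg : GoodL X g) :
    Good (Φ n X) (θ * c + 0 * g) := by
  rw [zero_mul, add_zero]
  exact H1 n X c hX hc

end Abstract

/-! ## §2 The right-divergenced leg tower: g60's END with the slaved term, predicate currency -/

section Leg

variable {d : ℕ} {N : ℕ} {kc : ℕ → ℝ} {K : ℕ → MKer (d + 1) (Fib d)}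
  {T F : ℕ → Fin (d + 1) → (Fin (d + 1) → ℤ) → Fin (d + 1) → (Fin (d + 1) → ℤ) → MKer (d + 1) (Fib d)}

/-- NOT IN PRINT; OUR BOOKKEEPING.  **THE (Q-L) END WITH THE SLAVED LONGITUDINAL TERM, PREDICATE CURRENCY** (= MY g60 `LegTowerRows.sz_rdiv_tower_le_of_window` with
`sz X ≤ c` ↦ `Good X c` and (H1) ↦ (H1♮) + (H3)).  Let `P` be ANY class of bi-tables containing `Δ 0 := fun s ↦ rdiv (T 0 s)` and the source divergences, closed under
`+` and preserved by the step maps on bounded tables; `Good` ANY subadditive, monotone size predicate; `GoodL` ANY predicate.  Suppose the leg tower obeys the closed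
one-step law at every level (`hstep` — g60 part 1's `rdiv_lin4_affine`), all kernels decay, all members and sources are bounded.  IF
(H1♮) **THE RULED k₀-WINDOW HYPOTHESIS**: for every level `n` and every bounded `W ∈ P`, `Good W c → GoodL W g →
Good (legChain kc K N n k₀ (fun s ↦ bsumPow N k₀ (W s))) (θ·c + Cg·g)` (`0 ≤ θ < 1`, `0 ≤ Cg`) — the k₀-fold PURE leg chain on k₀-fold block sums contracts MODULO the
longitudinal amplitude (on `{GoodL · 0}`, the slot-divergence-free class for `GoodL` := the slot-divergence letter, this is (H1)^{⊥}; OPEN — the located content of (Q-L));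
(H2) the window's pushed sources have `Good (Σ_{m<k₀} transport (legStepB kc K N) (n+m+1) (k₀−1−m) (rdiv ∘ F (n+m))) s` (`0 ≤ s`);
(H0) `Good (Δ i) M` on the first window (`0 ≤ M`);
(H3) `GoodL (Δ n) σ` for every `n` (`0 ≤ σ`) — THE SLAVED PART (for the even member: `rdiv (divW y_l)` = `rdiv` of the residual-free slaved divergence; NOT here);
THEN `Good (Δ n) (M + (Cg·σ + s)·(1 − θ)⁻¹)` for EVERY level `n`.  Nothing of (H1♮) ∕ (H3) is claimed. -/
theorem good_rdiv_tower_of_window_slaved (hK : ∀ m, ∃ δ C : ℝ, 0 < δ ∧ Decays (K m) C δ)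
    (hT : ∀ m, ∃ B : ℝ, ∀ κ u κ' u' x z a b, |T m κ u κ' u' x z a b| ≤ B) (hF : ∀ m, ∃ B : ℝ, ∀ κ u κ' u' x z a b, |F m κ u κ' u' x z a b| ≤ B)
    (hstep : ∀ m κ u κ' u', rdiv (T (m + 1) κ u κ' u')
      = legStep (kc m) (K m) (K m) N (fun κ u κ' u' => bsum N (rdiv (T m κ u κ' u'))) κ u κ' u' + rdiv (F m κ u κ' u'))
    (P : (Fin (d + 1) → (Fin (d + 1) → ℤ) → Fin (d + 1) → (Fin (d + 1) → ℤ) → MKer (d + 1) (Fib d)) → Prop)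
    (hP0 : P (fun κ u κ' u' => rdiv (T 0 κ u κ' u'))) (hPF : ∀ m, P (fun κ u κ' u' => rdiv (F m κ u κ' u')))
    (hPadd : ∀ X Y, P X → P Y → P (X + Y))
    (hPA : ∀ j (W : (Fin (d + 1) → (Fin (d + 1) → ℤ) → Fin (d + 1) → (Fin (d + 1) → ℤ) → MKer (d + 1) (Fib d))), P W →
      (∃ B : ℝ, ∀ κ u κ' u' x z a b, |W κ u κ' u' x z a b| ≤ B) → P (legStepB kc K N j W))
    {Good GoodL : (Fin (d + 1) → (Fin (d + 1) → ℤ) → Fin (d + 1) → (Fin (d + 1) → ℤ) → MKer (d + 1) (Fib d)) → ℝ → Prop}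
    (hGadd : ∀ X Y c c', Good X c → Good Y c' → Good (X + Y) (c + c')) (hGmono : ∀ X c c', c ≤ c' → Good X c → Good X c')
    {k₀ : ℕ} (hk : 0 < k₀) {θ Cg s M σ : ℝ} (hθ0 : 0 ≤ θ) (hθ1 : θ < 1) (hCg : 0 ≤ Cg) (hs : 0 ≤ s) (hM : 0 ≤ M) (hσ : 0 ≤ σ)
    (H1 : ∀ n (W : (Fin (d + 1) → (Fin (d + 1) → ℤ) → Fin (d + 1) → (Fin (d + 1) → ℤ) → MKer (d + 1) (Fib d))) (c g : ℝ), P W →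
      (∃ B : ℝ, ∀ κ u κ' u' x z a b, |W κ u κ' u' x z a b| ≤ B) → Good W c → GoodL W g →
        Good (legChain kc K N n k₀ (fun κ u κ' u' => bsumPow N k₀ (W κ u κ' u'))) (θ * c + Cg * g))
    (H2 : ∀ n, Good (∑ m ∈ Finset.range k₀, transport (legStepB kc K N) (n + m + 1) (k₀ - 1 - m) (fun κ u κ' u' => rdiv (F (n + m) κ u κ' u'))) s)
    (H0 : ∀ i, i < k₀ → Good (fun κ u κ' u' => rdiv (T i κ u κ' u')) M)
    (H3 : ∀ n, GoodL (fun κ u κ' u' => rdiv (T n κ u κ' u')) σ) (n : ℕ) :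
    Good (fun κ u κ' u' => rdiv (T n κ u κ' u')) (M + (Cg * σ + s) * (1 - θ)⁻¹) := by
  refine good_tower_of_kfold_slaved (Good := Good) (GoodL := GoodL)
    (P := fun W => P W ∧ ∃ B : ℝ, ∀ κ u κ' u' x z a b, |W κ u κ' u' x z a b| ≤ B)
    (x := fun i => fun κ u κ' u' => rdiv (T i κ u κ' u')) (Φ := fun m W => transport (legStepB kc K N) m k₀ W)
    (S := fun m => ∑ j ∈ Finset.range k₀, transport (legStepB kc K N) (m + j + 1) (k₀ - 1 - j) (fun κ u κ' u' => rdiv (F (m + j) κ u κ' u')))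
    hGadd hGmono hk (fun m => rdiv_tower_window hK hT hF hstep m k₀)
    (fun m => ⟨mem_rdiv_tower hT hstep P hP0 hPF hPadd hPA m, bddTab_rdiv (hT m)⟩) hθ0 hθ1 hCg hs hM hσ
    (fun m W c g hW hc hg => ?_) H2 H0 H3 n
  -- the homogeneous window term is the pure chain on the block-summed member (g60 part 3)
  show Good (transport (legStepB kc K N) m k₀ W) (θ * c + Cg * g)
  rw [transport_legStepB_eq hK m k₀ hW.2]
  exact H1 m W c g hW.1 hW.2 hc hg

/-- NOT IN PRINT; OUR BOOKKEEPING.  **THE SAME ON THE BOUNDED CLASS** (`P :=` «entrywise bounded»: the four class rows are automatic — g60 part 3's `bddTab_rdiv` ∕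
leaf-01's `bdd₄_add` ∕ `bddTab_legStepB`), so only (H1♮) on bounded tables, (H2), (H0), (H3) remain. -/
theorem good_rdiv_tower_of_window_slaved_bdd (hK : ∀ m, ∃ δ C : ℝ, 0 < δ ∧ Decays (K m) C δ)
    (hT : ∀ m, ∃ B : ℝ, ∀ κ u κ' u' x z a b, |T m κ u κ' u' x z a b| ≤ B) (hF : ∀ m, ∃ B : ℝ, ∀ κ u κ' u' x z a b, |F m κ u κ' u' x z a b| ≤ B)
    (hstep : ∀ m κ u κ' u', rdiv (T (m + 1) κ u κ' u')
      = legStep (kc m) (K m) (K m) N (fun κ u κ' u' => bsum N (rdiv (T m κ u κ' u'))) κ u κ' u' + rdiv (F m κ u κ' u'))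
    {Good GoodL : (Fin (d + 1) → (Fin (d + 1) → ℤ) → Fin (d + 1) → (Fin (d + 1) → ℤ) → MKer (d + 1) (Fib d)) → ℝ → Prop}
    (hGadd : ∀ X Y c c', Good X c → Good Y c' → Good (X + Y) (c + c')) (hGmono : ∀ X c c', c ≤ c' → Good X c → Good X c')
    {k₀ : ℕ} (hk : 0 < k₀) {θ Cg s M σ : ℝ} (hθ0 : 0 ≤ θ) (hθ1 : θ < 1) (hCg : 0 ≤ Cg) (hs : 0 ≤ s) (hM : 0 ≤ M) (hσ : 0 ≤ σ)
    (H1 : ∀ n (W : (Fin (d + 1) → (Fin (d + 1) → ℤ) → Fin (d + 1) → (Fin (d + 1) → ℤ) → MKer (d + 1) (Fib d))) (c g : ℝ),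
      (∃ B : ℝ, ∀ κ u κ' u' x z a b, |W κ u κ' u' x z a b| ≤ B) → Good W c → GoodL W g →
        Good (legChain kc K N n k₀ (fun κ u κ' u' => bsumPow N k₀ (W κ u κ' u'))) (θ * c + Cg * g))
    (H2 : ∀ n, Good (∑ m ∈ Finset.range k₀, transport (legStepB kc K N) (n + m + 1) (k₀ - 1 - m) (fun κ u κ' u' => rdiv (F (n + m) κ u κ' u'))) s)
    (H0 : ∀ i, i < k₀ → Good (fun κ u κ' u' => rdiv (T i κ u κ' u')) M)
    (H3 : ∀ n, GoodL (fun κ u κ' u' => rdiv (T n κ u κ' u')) σ) (n : ℕ) :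
    Good (fun κ u κ' u' => rdiv (T n κ u κ' u')) (M + (Cg * σ + s) * (1 - θ)⁻¹) :=
  good_rdiv_tower_of_window_slaved hK hT hF hstep
    (fun W => ∃ B : ℝ, ∀ κ u κ' u' x z a b, |W κ u κ' u' x z a b| ≤ B)
    (bddTab_rdiv (hT 0)) (fun m => bddTab_rdiv (hF m)) (fun _ _ hX hY => bdd₄_add hX hY)
    (fun j _ hW _ => bddTab_legStepB hK j hW) hGadd hGmono hk hθ0 hθ1 hCg hs hM hσ (fun n W c g _ hW hc hg => H1 n W c g hW hc hg) H2 H0 H3 n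

/-- NOT IN PRINT; OUR BOOKKEEPING.  **THE SAME FROM THE AFFINE RECURSION ITSELF**: `T (m+1) = lin4 (c m) (K m) N (T m) + F m` with (hH m) (constants `cH m`), (hMf m),
`N ≥ 1`, `T 0` and the sources bounded (every member is then bounded by leaf-01's `lin4_bdd`; `hstep` by g60 part 1's `rdiv_lin4_affine`), `kc m = −(c m·cH m)`. -/
theorem good_rdiv_tower_of_window_slaved_of_rec {c cH : ℕ → ℝ} (hK : ∀ m, ∃ δ C : ℝ, 0 < δ ∧ Decays (K m) C δ) (hN : 1 ≤ N)
    (hT0 : ∃ B : ℝ, ∀ κ u κ' u' x z a b, |T 0 κ u κ' u' x z a b| ≤ B) (hF : ∀ m, ∃ B : ℝ, ∀ κ u κ' u' x z a b, |F m κ u κ' u' x z a b| ≤ B)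
    (hrec : ∀ m, T (m + 1) = lin4 (c m) (K m) N (T m) + F m)
    (hH : ∀ m (y : Site (d + 1)) (κ : Fin (d + 1)) (u : Site (d + 1)),
      ∑ μ, (colH (K m) N μ (y - unitVec μ) κ u - colH (K m) N μ y κ u) = cH m * gaugeWt N y κ u)
    (hMf : ∀ m (y x₂ : Site (d + 1)) (ρ : Fin (d + 1)),
      ∑ μ, (K m x₂ ((N : ℤ) • (y - unitVec μ)) (Sum.inr ρ) (Sum.inr μ) - K m x₂ ((N : ℤ) • y) (Sum.inr ρ) (Sum.inr μ)) = 0)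
    (P : (Fin (d + 1) → (Fin (d + 1) → ℤ) → Fin (d + 1) → (Fin (d + 1) → ℤ) → MKer (d + 1) (Fib d)) → Prop)
    (hP0 : P (fun κ u κ' u' => rdiv (T 0 κ u κ' u'))) (hPF : ∀ m, P (fun κ u κ' u' => rdiv (F m κ u κ' u')))
    (hPadd : ∀ X Y, P X → P Y → P (X + Y))
    (hPA : ∀ j (W : (Fin (d + 1) → (Fin (d + 1) → ℤ) → Fin (d + 1) → (Fin (d + 1) → ℤ) → MKer (d + 1) (Fib d))), P W →
      (∃ B : ℝ, ∀ κ u κ' u' x z a b, |W κ u κ' u' x z a b| ≤ B) → P (legStepB (fun m => -(c m * cH m)) K N j W))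
    {Good GoodL : (Fin (d + 1) → (Fin (d + 1) → ℤ) → Fin (d + 1) → (Fin (d + 1) → ℤ) → MKer (d + 1) (Fib d)) → ℝ → Prop}
    (hGadd : ∀ X Y c c', Good X c → Good Y c' → Good (X + Y) (c + c')) (hGmono : ∀ X c c', c ≤ c' → Good X c → Good X c')
    {k₀ : ℕ} (hk : 0 < k₀) {θ Cg s M σ : ℝ} (hθ0 : 0 ≤ θ) (hθ1 : θ < 1) (hCg : 0 ≤ Cg) (hs : 0 ≤ s) (hM : 0 ≤ M) (hσ : 0 ≤ σ)
    (H1 : ∀ n (W : (Fin (d + 1) → (Fin (d + 1) → ℤ) → Fin (d + 1) → (Fin (d + 1) → ℤ) → MKer (d + 1) (Fib d))) (c' g : ℝ), P W →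
      (∃ B : ℝ, ∀ κ u κ' u' x z a b, |W κ u κ' u' x z a b| ≤ B) → Good W c' → GoodL W g →
        Good (legChain (fun m => -(c m * cH m)) K N n k₀ (fun κ u κ' u' => bsumPow N k₀ (W κ u κ' u'))) (θ * c' + Cg * g))
    (H2 : ∀ n, Good (∑ m ∈ Finset.range k₀, transport (legStepB (fun m => -(c m * cH m)) K N) (n + m + 1) (k₀ - 1 - m)
      (fun κ u κ' u' => rdiv (F (n + m) κ u κ' u'))) s)
    (H0 : ∀ i, i < k₀ → Good (fun κ u κ' u' => rdiv (T i κ u κ' u')) M)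
    (H3 : ∀ n, GoodL (fun κ u κ' u' => rdiv (T n κ u κ' u')) σ) (n : ℕ) :
    Good (fun κ u κ' u' => rdiv (T n κ u κ' u')) (M + (Cg * σ + s) * (1 - θ)⁻¹) := by
  have hTb : ∀ m, ∃ B : ℝ, ∀ κ u κ' u' x z a b, |T m κ u κ' u' x z a b| ≤ B := by
    intro m
    induction m with
    | zero => exact hT0
    | succ m ih =>
      obtain ⟨δ, C, hδ, hKm⟩ := hK m
      rw [hrec m]
      exact bdd₄_add (Lin4Additive.lin4_bdd hKm hδ (c m) N ih) (hF m)
  refine good_rdiv_tower_of_window_slaved hK hTb hF (fun m κ u κ' u' => ?_) P hP0 hPF hPadd hPA hGadd hGmono hk hθ0 hθ1 hCg hs hM hσ H1 H2 H0 H3 n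
  obtain ⟨δ, C, hδ, hKm⟩ := hK m
  obtain ⟨B, hB⟩ := hTb m
  rw [hrec m]
  exact rdiv_lin4_affine hKm hδ hN (c m) hB (hH m) (hMf m) (F m) κ u κ' u'

end Leg

/-! ## §3 The comb ∕ wall instance, and the `LocStencil₂` currency -/

section Comb

variable {d : ℕ} {Lc : ℕ} [NeZero Lc] {r : ℕ → Fin (d + 1) → ℕ}

/-- NOT IN PRINT; OUR BOOKKEEPING.  **THE (Q-L) END WITH THE SLAVED TERM FOR THE DRESSED COMB TOWER** `K♮ᴱ_m = unitK (sfStep Lc m) (smStep d Lc m) (coDressKBmAt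
(toSite (r m)) Lc (KInvStep Lc m))` (`N = Lc`, couplings `c m`, `kc m = −(c m·(Lc^{d+1})⁻¹)`; in-block roots `r m`; g58's `hH_unitK_comb` ∕ `hM_unitK_comb` supply the
Ward laws): modulo (H1♮) ∕ (H2) ∕ (H0) ∕ (H3) in the consumer's size predicate `Good`, `Good (Δ n) (M + (Cg·σ + s)·(1 − θ)⁻¹)` for every level. -/
theorem good_rdiv_tower_of_window_slaved_comb (hr : ∀ m, r m ∈ box (d + 1) Lc) (c : ℕ → ℝ)
    {T F : ℕ → Fin (d + 1) → (Fin (d + 1) → ℤ) → Fin (d + 1) → (Fin (d + 1) → ℤ) → MKer (d + 1) (Fib d)}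
    (hT0 : ∃ B : ℝ, ∀ κ u κ' u' x z a b, |T 0 κ u κ' u' x z a b| ≤ B) (hF : ∀ m, ∃ B : ℝ, ∀ κ u κ' u' x z a b, |F m κ u κ' u' x z a b| ≤ B)
    (hrec : ∀ m, T (m + 1) = lin4 (c m) (unitK (sfStep Lc m) (smStep d Lc m) (coDressKBmAt (toSite (r m)) Lc (KInvStep (d := d) Lc m))) Lc (T m) + F m)
    (P : (Fin (d + 1) → (Fin (d + 1) → ℤ) → Fin (d + 1) → (Fin (d + 1) → ℤ) → MKer (d + 1) (Fib d)) → Prop)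
    (hP0 : P (fun κ u κ' u' => rdiv (T 0 κ u κ' u'))) (hPF : ∀ m, P (fun κ u κ' u' => rdiv (F m κ u κ' u')))
    (hPadd : ∀ X Y, P X → P Y → P (X + Y))
    (hPA : ∀ j (W : (Fin (d + 1) → (Fin (d + 1) → ℤ) → Fin (d + 1) → (Fin (d + 1) → ℤ) → MKer (d + 1) (Fib d))), P W →
      (∃ B : ℝ, ∀ κ u κ' u' x z a b, |W κ u κ' u' x z a b| ≤ B) →
        P (legStepB (fun m => -(c m * ((Lc : ℝ) ^ (d + 1))⁻¹))
          (fun m => unitK (sfStep Lc m) (smStep d Lc m) (coDressKBmAt (toSite (r m)) Lc (KInvStep (d := d) Lc m))) Lc j W))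
    {Good GoodL : (Fin (d + 1) → (Fin (d + 1) → ℤ) → Fin (d + 1) → (Fin (d + 1) → ℤ) → MKer (d + 1) (Fib d)) → ℝ → Prop}
    (hGadd : ∀ X Y c c', Good X c → Good Y c' → Good (X + Y) (c + c')) (hGmono : ∀ X c c', c ≤ c' → Good X c → Good X c')
    {k₀ : ℕ} (hk : 0 < k₀) {θ Cg s M σ : ℝ} (hθ0 : 0 ≤ θ) (hθ1 : θ < 1) (hCg : 0 ≤ Cg) (hs : 0 ≤ s) (hM : 0 ≤ M) (hσ : 0 ≤ σ)
    (H1 : ∀ n (W : (Fin (d + 1) → (Fin (d + 1) → ℤ) → Fin (d + 1) → (Fin (d + 1) → ℤ) → MKer (d + 1) (Fib d))) (c' g : ℝ), P W →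
      (∃ B : ℝ, ∀ κ u κ' u' x z a b, |W κ u κ' u' x z a b| ≤ B) → Good W c' → GoodL W g →
        Good (legChain (fun m => -(c m * ((Lc : ℝ) ^ (d + 1))⁻¹))
          (fun m => unitK (sfStep Lc m) (smStep d Lc m) (coDressKBmAt (toSite (r m)) Lc (KInvStep (d := d) Lc m))) Lc n k₀
          (fun κ u κ' u' => bsumPow Lc k₀ (W κ u κ' u'))) (θ * c' + Cg * g))
    (H2 : ∀ n, Good (∑ m ∈ Finset.range k₀, transport (legStepB (fun m => -(c m * ((Lc : ℝ) ^ (d + 1))⁻¹))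
      (fun m => unitK (sfStep Lc m) (smStep d Lc m) (coDressKBmAt (toSite (r m)) Lc (KInvStep (d := d) Lc m))) Lc) (n + m + 1) (k₀ - 1 - m)
      (fun κ u κ' u' => rdiv (F (n + m) κ u κ' u'))) s)
    (H0 : ∀ i, i < k₀ → Good (fun κ u κ' u' => rdiv (T i κ u κ' u')) M)
    (H3 : ∀ n, GoodL (fun κ u κ' u' => rdiv (T n κ u κ' u')) σ) (n : ℕ) :
    Good (fun κ u κ' u' => rdiv (T n κ u κ' u')) (M + (Cg * σ + s) * (1 - θ)⁻¹) := by
  have hK : ∀ m, ∃ δ C : ℝ, 0 < δ ∧ Decays (unitK (sfStep Lc m) (smStep d Lc m) (coDressKBmAt (toSite (r m)) Lc (KInvStep (d := d) Lc m))) C δ := by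
    intro m
    obtain ⟨δK, CK, hδK, -, hG⟩ := decays_coDressKBmAt_KInvStep (d := d) (hr m) m
    exact ⟨δK, _, hδK, decays_unitK hG⟩
  exact good_rdiv_tower_of_window_slaved_of_rec (cH := fun _ => ((Lc : ℝ) ^ (d + 1))⁻¹) hK (one_le_of_neZero Lc) hT0 hF hrec
    (fun m => hH_unitK_comb (hr m) m) (fun m => hM_unitK_comb m) P hP0 hPF hPadd hPA hGadd hGmono hk hθ0 hθ1 hCg hs hM hσ H1 H2 H0 H3 n

/-- NOT IN PRINT; OUR BOOKKEEPING.  **`LocStencil₂` CURRENCY** — the size predicate of the LEG LETTER ROWS: `Good X C := LocStencil₂ X C δ` at ONE rate `δ` is subadditive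
(`locStencil₂_add`) and monotone in the constant (`locStencil₂_mono`), so for the dressed comb tower with a FIXED in-block root `r` (the parity member's law):
(H1♮)_δ ∧ (H2)_δ ∧ (H0)_δ ∧ (H3) ⟹ `∀ n, LocStencil₂ (fun s ↦ rdiv (T n s)) (M + (Cg·σ + s)·(1 − θ)⁻¹) δ` — ONE constant, EVERY level: the right-leg letter row
up to the sign of the difference (FILE 2).  The four hypotheses are DISPLAYED, not discharged. -/
theorem locStencil₂_rdiv_tower_of_window_slaved_comb {r : Fin (d + 1) → ℕ} (hr : r ∈ box (d + 1) Lc) (c : ℕ → ℝ)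
    {T F : ℕ → Fin (d + 1) → (Fin (d + 1) → ℤ) → Fin (d + 1) → (Fin (d + 1) → ℤ) → MKer (d + 1) (Fib d)}
    (hT0 : ∃ B : ℝ, ∀ κ u κ' u' x z a b, |T 0 κ u κ' u' x z a b| ≤ B) (hF : ∀ m, ∃ B : ℝ, ∀ κ u κ' u' x z a b, |F m κ u κ' u' x z a b| ≤ B)
    (hrec : ∀ m, T (m + 1) = lin4 (c m) (unitK (sfStep Lc m) (smStep d Lc m) (coDressKBmAt (toSite r) Lc (KInvStep (d := d) Lc m))) Lc (T m) + F m)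
    (P : (Fin (d + 1) → (Fin (d + 1) → ℤ) → Fin (d + 1) → (Fin (d + 1) → ℤ) → MKer (d + 1) (Fib d)) → Prop)
    (hP0 : P (fun κ u κ' u' => rdiv (T 0 κ u κ' u'))) (hPF : ∀ m, P (fun κ u κ' u' => rdiv (F m κ u κ' u')))
    (hPadd : ∀ X Y, P X → P Y → P (X + Y))
    (hPA : ∀ j (W : (Fin (d + 1) → (Fin (d + 1) → ℤ) → Fin (d + 1) → (Fin (d + 1) → ℤ) → MKer (d + 1) (Fib d))), P W →
      (∃ B : ℝ, ∀ κ u κ' u' x z a b, |W κ u κ' u' x z a b| ≤ B) →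
        P (legStepB (fun m => -(c m * ((Lc : ℝ) ^ (d + 1))⁻¹))
          (fun m => unitK (sfStep Lc m) (smStep d Lc m) (coDressKBmAt (toSite r) Lc (KInvStep (d := d) Lc m))) Lc j W))
    {GoodL : (Fin (d + 1) → (Fin (d + 1) → ℤ) → Fin (d + 1) → (Fin (d + 1) → ℤ) → MKer (d + 1) (Fib d)) → ℝ → Prop} (δ : ℝ)
    {k₀ : ℕ} (hk : 0 < k₀) {θ Cg s M σ : ℝ} (hθ0 : 0 ≤ θ) (hθ1 : θ < 1) (hCg : 0 ≤ Cg) (hs : 0 ≤ s) (hM : 0 ≤ M) (hσ : 0 ≤ σ)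
    (H1 : ∀ n (W : (Fin (d + 1) → (Fin (d + 1) → ℤ) → Fin (d + 1) → (Fin (d + 1) → ℤ) → MKer (d + 1) (Fib d))) (C g : ℝ), P W →
      (∃ B : ℝ, ∀ κ u κ' u' x z a b, |W κ u κ' u' x z a b| ≤ B) → LocStencil₂ W C δ → GoodL W g →
        LocStencil₂ (legChain (fun m => -(c m * ((Lc : ℝ) ^ (d + 1))⁻¹))
          (fun m => unitK (sfStep Lc m) (smStep d Lc m) (coDressKBmAt (toSite r) Lc (KInvStep (d := d) Lc m))) Lc n k₀
          (fun κ u κ' u' => bsumPow Lc k₀ (W κ u κ' u'))) (θ * C + Cg * g) δ)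
    (H2 : ∀ n, LocStencil₂ (∑ m ∈ Finset.range k₀, transport (legStepB (fun m => -(c m * ((Lc : ℝ) ^ (d + 1))⁻¹))
      (fun m => unitK (sfStep Lc m) (smStep d Lc m) (coDressKBmAt (toSite r) Lc (KInvStep (d := d) Lc m))) Lc) (n + m + 1) (k₀ - 1 - m)
      (fun κ u κ' u' => rdiv (F (n + m) κ u κ' u'))) s δ)
    (H0 : ∀ i, i < k₀ → LocStencil₂ (fun κ u κ' u' => rdiv (T i κ u κ' u')) M δ)
    (H3 : ∀ n, GoodL (fun κ u κ' u' => rdiv (T n κ u κ' u')) σ) (n : ℕ) :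
    LocStencil₂ (fun κ u κ' u' => rdiv (T n κ u κ' u')) (M + (Cg * σ + s) * (1 - θ)⁻¹) δ :=
  good_rdiv_tower_of_window_slaved_comb (r := fun _ => r) (fun _ => hr) c hT0 hF hrec P hP0 hPF hPadd hPA
    (Good := fun X C => LocStencil₂ X C δ) (GoodL := GoodL)
    (fun _ _ _ _ hX hY => locStencil₂_add hX hY) (fun _ _ _ hCC hX => locStencil₂_mono hX hCC)
    hk hθ0 hθ1 hCg hs hM hσ H1 H2 H0 H3 n

end Comb

end Summit.QuantumFields.BalabanUV.Beta.GAN24.LegTowerSlavedRows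
end
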